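import Literature.Analysis.FluidPDE.VectorCalculus
import HarnessLib

/-!
# Stagnation-point identities, II (R12′ / RATE-AUDIT §6.6.4 (c), S4): the linearised vorticity
# equation READ AT a non-degenerate stagnation point of a steady host

HONEST FRAMING (cell `ns-blowup`, seat `ns-blowup-lit3` g7 for the RATE-AUDIT v1.5 writer; human
ruling D-0035 / D-0074). Nothing here is a claim about Navier–Stokes blow-up or regularity. WHAT
THIS IS NOT: not a statement about the marginal tower N1*, not a spectral theorem; it is the
POINTWISE linear algebra behind `instab/RATE-AUDIT.md` §6.6.4 (c) «EIGENMODE IDENTITY AT THE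
STAGNATION POINT (CLAIM A6; EXACT, linear — S4 for normal modes)», companion of
`StagnationPointIdentities.lean` (S1)/(S2):

> (c) For `(ũ, ω̃)e^{γt}` solving NS linearised about a steady host with `[Ū, Ω̄] = 0` (fixed force)
> and `x_α` non-degenerate: `γω̃(x_α) = DŪ(x_α)ω̃(x_α) − DΩ̄(x_α)ũ(x_α) + νΔω̃(x_α)`; Beltrami
> (`DΩ̄ = λDŪ`): `γω̃ = A(ω̃ − λũ) + νΔω̃`, and along `e₁`:
> `(σ₁ − γ)ω̃₁(x_α) = σ₁λũ₁(x_α) − νΔω̃₁(x_α)`. Readings: a steady co-signed pinned rope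
> (`γ ≥ 0`, `ω̃₁(x_α) ≠ 0`, `ũ₁(x_α) = 0`) has `γ = σ₁(1 − (δ_B/δ)²) − ν/ℓ₁²` for transverse Gaussian
> width `δ` and axial curvature scale `ℓ₁` (`δ_B² = 4ν/σ₁`) — FATTER than Burgers by
> `(1 − γ/σ₁ − ν/σ₁ℓ₁²)^{−1/2}`; `ũ₁(x_α) ≠ 0` is the displacement channel; `ω̃₁(x_α) = 0` forced by
> symmetry ⇒ polarity reverses through the α-point.

The fluid content is the LINEARISED VORTICITY EQUATION about a steady host `(Ū, Ω̄ = curl Ū)`,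
`∂ₜω̃ + (Ū·∇)ω̃ + (ũ·∇)Ω̄ = (Ω̄·∇)ũ + (ω̃·∇)Ū + νΔω̃ (+ curl of the linearised forcing, zero for a
fixed force)`, quoted — as in (S1)/(S2) — through the tree's convective derivative
`Literature.Analysis.FluidPDE.convect` (`convect u v x = Dv(x)[u x]`) as a HYPOTHESIS at the one point
`x₀`; (S4) is what that equation says at a point where `Ū(x₀) = 0` (stagnation) and `Ω̄(x₀) = 0`
((S1): the host vorticity vanishes at non-degenerate stagnation points of a steady Euler / Beltrami
host): the two transport terms `(Ū·∇)ω̃`, `(Ω̄·∇)ũ` drop and the tilting/stretching terms become the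
Jacobians `DŪ(x₀)`, `DΩ̄(x₀)` acting on the perturbation's values. Everything is over an abstract
real inner-product space `E`; the remainder `R` stands for `νΔω̃(x₀)` (plus forcing curl), the vector
`a` for `∂ₜω̃(x₀)` (`a = γ ω̃(x₀)` for a normal mode). All statements are theorems; no named facts.
-/

namespace Summit.NavierStokesRegularity.FluidComputer.StagnationPointIdentities

open Literature.Analysis.FluidPDE
open scoped RealInnerProductSpace

section General

variable {E : Type*} [NormedAddCommGroup E] [InnerProductSpace ℝ E]

/-- **(S4), time-dependent form.** If the linearised vorticity balance
`a + (U·∇)w + (u·∇)W = (W·∇)u + (w·∇)U + R` holds at `x₀` (`a = ∂ₜω̃(x₀)`, `R = νΔω̃(x₀)` + forcing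
curl), and `x₀` is a stagnation point of the host with vanishing host vorticity (`U x₀ = 0`,
`W x₀ = 0` — the latter is (S1) for a steady Euler / Beltrami host), then
`a = DU(x₀) (w x₀) − DW(x₀) (u x₀) + R`: only tilting/stretching by the host Jacobians survives. -/
theorem linearised_vorticity_at_stagnation {U W u w : E → E} {x₀ a R : E}
    (hbal : a + convect U w x₀ + convect u W x₀ = convect W u x₀ + convect w U x₀ + R)
    (hU : U x₀ = 0) (hW : W x₀ = 0) :
    a = fderiv ℝ U x₀ (w x₀) - fderiv ℝ W x₀ (u x₀) + R := by
  simp only [convect_apply, hU, hW, map_zero, add_zero, zero_add] at hbal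
  have h2 : a = fderiv ℝ U x₀ (w x₀) + R - fderiv ℝ W x₀ (u x₀) := eq_sub_of_add_eq hbal
  rw [h2]
  abel

/-- **(S4) for a normal mode** `(ũ, ω̃) e^{γt}`: `a = γ ω̃(x₀)`, so
`γ w(x₀) = DU(x₀) w(x₀) − DW(x₀) u(x₀) + R` — RATE-AUDIT §6.6.4 (c), first display. -/
theorem eigenmode_identity {U W u w : E → E} {x₀ R : E} {γ : ℝ}
    (hbal : γ • w x₀ + convect U w x₀ + convect u W x₀ = convect W u x₀ + convect w U x₀ + R)
    (hU : U x₀ = 0) (hW : W x₀ = 0) :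
    γ • w x₀ = fderiv ℝ U x₀ (w x₀) - fderiv ℝ W x₀ (u x₀) + R :=
  linearised_vorticity_at_stagnation hbal hU hW

/-- **(S4), Beltrami host** `W = λ U` (`DW(x₀) = λ DU(x₀)`; ABC flows: `λ = 1`): the identity
becomes `γ w(x₀) = DU(x₀) (w(x₀) − λ u(x₀)) + R` — «`γω̃ = A(ω̃ − λũ) + νΔω̃`». -/
theorem eigenmode_identity_beltrami {U u w : E → E} {x₀ R : E} {γ lam : ℝ}
    (hdiff : DifferentiableAt ℝ U x₀)
    (hbal : γ • w x₀ + convect U w x₀ + convect u (fun y => lam • U y) x₀ =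
      convect (fun y => lam • U y) u x₀ + convect w U x₀ + R)
    (hU : U x₀ = 0) :
    γ • w x₀ = fderiv ℝ U x₀ (w x₀ - lam • u x₀) + R := by
  have hW : (fun y => lam • U y) x₀ = 0 := by simp [hU]
  have h := linearised_vorticity_at_stagnation hbal hU hW
  rw [h, fderiv_fun_const_smul hdiff, smul_apply, map_sub, map_smul]

/-- **(S4) along a principal axis of a SYMMETRIC host Jacobian.** If `DU(x₀)` has `e` as an
eigen-direction in the self-adjoint sense `⟪DU(x₀) v, e⟫ = σ₁ ⟪v, e⟫` for all `v` (at a steady-Euler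
stagnation point `DU(x₀)` is symmetric, RATE-AUDIT §6.6.4 (b); `e = e₁` its stretching axis,
`σ₁` the stretching rate), then the Beltrami identity projects to the scalar relation
`(σ₁ − γ) ⟪w(x₀), e⟫ = σ₁ λ ⟪u(x₀), e⟫ − ⟪R, e⟫` —
«`(σ₁ − γ) ω̃₁(x_α) = σ₁ λ ũ₁(x_α) − νΔω̃₁(x_α)`». -/
theorem eigenmode_identity_axis {A : E →L[ℝ] E} {w u R e : E} {γ lam σ₁ : ℝ}
    (hid : γ • w = A (w - lam • u) + R) (hA : ∀ v : E, ⟪A v, e⟫ = σ₁ * ⟪v, e⟫) :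
    (σ₁ - γ) * ⟪w, e⟫ = σ₁ * lam * ⟪u, e⟫ - ⟪R, e⟫ := by
  have h := congrArg (fun v => ⟪v, e⟫) hid
  simp only [inner_add_left, inner_smul_left, hA, inner_sub_left, RCLike.conj_to_real] at h
  linarith

/-- The two previous steps combined: from the pointwise balance about a Beltrami host with a
symmetric Jacobian at the stagnation point to the scalar `e₁`-relation. -/
theorem eigenmode_identity_beltrami_axis {U u w : E → E} {x₀ R e : E} {γ lam σ₁ : ℝ}
    (hdiff : DifferentiableAt ℝ U x₀)
    (hbal : γ • w x₀ + convect U w x₀ + convect u (fun y => lam • U y) x₀ =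
      convect (fun y => lam • U y) u x₀ + convect w U x₀ + R)
    (hU : U x₀ = 0) (hA : ∀ v : E, ⟪fderiv ℝ U x₀ v, e⟫ = σ₁ * ⟪v, e⟫) :
    (σ₁ - γ) * ⟪w x₀, e⟫ = σ₁ * lam * ⟪u x₀, e⟫ - ⟪R, e⟫ :=
  eigenmode_identity_axis (eigenmode_identity_beltrami hdiff hbal hU) hA

end General

/-! ### Readings of the `e₁`-relation (RATE-AUDIT §6.6.4 (c) "Readings"; real arithmetic) -/

section Readings

/-- **Pinned co-signed rope: the growth rate is the stretching rate minus the viscous decrement.**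
In the `e₁`-relation `(σ₁ − γ) w₁ = σ₁ λ u₁ − R₁` suppose the mode is PINNED (`u₁ = 0`: no
displacement of the core through the stagnation point), CO-SIGNED with nonzero axial vorticity
(`w₁ ≠ 0`), and the viscous remainder along `e₁` is a negative multiple of the core vorticity,
`R₁ = −κ w₁` (`R₁ = νΔω̃₁(x_α)`; e.g. `κ = ν(4/δ² + 1/ℓ₁²)` for a transverse Gaussian of width `δ`
with axial curvature scale `ℓ₁`). Then `γ = σ₁ − κ`. -/
theorem growthRate_of_pinned {σ₁ γ lam u₁ w₁ R₁ κ : ℝ}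
    (hid : (σ₁ - γ) * w₁ = σ₁ * lam * u₁ - R₁) (hu : u₁ = 0) (hR : R₁ = -κ * w₁)
    (hw : w₁ ≠ 0) : γ = σ₁ - κ := by
  rw [hu, mul_zero, zero_sub, hR] at hid
  have h : (σ₁ - γ - κ) * w₁ = 0 := by linarith
  rcases mul_eq_zero.1 h with h0 | h0
  · linarith
  · exact absurd h0 hw

/-- **The Gaussian-core instance**: `κ = ν(4/δ² + 1/ℓ₁²)` gives
`γ = σ₁ − 4ν/δ² − ν/ℓ₁² = σ₁ (1 − (δ_B/δ)²) − ν/ℓ₁²` with the Burgers width `δ_B² = 4ν/σ₁`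
(`σ₁ ≠ 0`, `δ ≠ 0`). -/
theorem growthRate_gaussian_core {σ₁ γ ν δ ℓ₁ : ℝ} (hσ : σ₁ ≠ 0) (hδ : δ ≠ 0)
    (hγ : γ = σ₁ - ν * (4 / δ ^ 2 + 1 / ℓ₁ ^ 2)) :
    γ = σ₁ * (1 - (4 * ν / σ₁) / δ ^ 2) - ν / ℓ₁ ^ 2 := by
  rw [hγ]
  field_simp
  ring

/-- **«FATTER than Burgers».** If `γ = σ₁ − 4ν/δ² − ν/ℓ₁²` with `σ₁, ν, δ, ℓ₁ > 0` and the mode does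
not decay (`γ ≥ 0`), then the core is strictly wider than the Burgers width: `δ² > δ_B² = 4ν/σ₁`. -/
theorem burgersWidth_sq_lt_of_nonneg_growth {σ₁ γ ν δ ℓ₁ : ℝ} (hσ : 0 < σ₁) (hν : 0 < ν)
    (hδ : 0 < δ) (hℓ : 0 < ℓ₁) (hγ : γ = σ₁ - ν * (4 / δ ^ 2 + 1 / ℓ₁ ^ 2)) (hγ0 : 0 ≤ γ) :
    4 * ν / σ₁ < δ ^ 2 := by
  have hδ2 : 0 < δ ^ 2 := by positivity
  have hℓ2 : 0 < ℓ₁ ^ 2 := by positivity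
  have h1 : ν * (4 / δ ^ 2 + 1 / ℓ₁ ^ 2) ≤ σ₁ := by linarith
  have h2 : 0 < ν * (1 / ℓ₁ ^ 2) := by positivity
  have h3 : ν * (4 / δ ^ 2) < σ₁ := by nlinarith
  have h4 : 4 * ν < σ₁ * δ ^ 2 := by
    have h5 : ν * (4 / δ ^ 2) * δ ^ 2 < σ₁ * δ ^ 2 := mul_lt_mul_of_pos_right h3 hδ2
    have h6 : ν * (4 / δ ^ 2) * δ ^ 2 = 4 * ν := by field_simp
    linarith
  rw [div_lt_iff₀ hσ]
  linarith

/-- The exact fattening factor: for `γ = σ₁ − 4ν/δ² − ν/ℓ₁²` with `σ₁ − γ − ν/ℓ₁² > 0`,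
`δ² = δ_B² · (1 − γ/σ₁ − ν/(σ₁ℓ₁²))⁻¹`, `δ_B² = 4ν/σ₁` — «FATTER than Burgers by
`(1 − γ/σ₁ − ν/σ₁ℓ₁²)^{−1/2}`». -/
theorem coreWidth_sq_eq {σ₁ γ ν δ ℓ₁ : ℝ} (hσ : 0 < σ₁) (hδ : δ ≠ 0) (hℓ : ℓ₁ ≠ 0)
    (hγ : γ = σ₁ - ν * (4 / δ ^ 2 + 1 / ℓ₁ ^ 2)) (hpos : 0 < σ₁ - γ - ν / ℓ₁ ^ 2) :
    δ ^ 2 = (4 * ν / σ₁) * (1 - γ / σ₁ - ν / (σ₁ * ℓ₁ ^ 2))⁻¹ := by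
  have hδ2 : δ ^ 2 ≠ 0 := pow_ne_zero 2 hδ
  have hℓ2 : ℓ₁ ^ 2 ≠ 0 := pow_ne_zero 2 hℓ
  have hkey : σ₁ - γ - ν / ℓ₁ ^ 2 = 4 * ν / δ ^ 2 := by
    rw [hγ]; field_simp; ring
  have hν : ν ≠ 0 := by
    have h := hpos
    rw [hkey] at h
    have h4 : 0 < 4 * ν := (div_pos_iff_of_pos_right (by positivity)).1 h
    exact (by linarith : 0 < ν).ne'
  have hσ' : σ₁ ≠ 0 := hσ.ne'
  have hfac : 1 - γ / σ₁ - ν / (σ₁ * ℓ₁ ^ 2) = (σ₁ - γ - ν / ℓ₁ ^ 2) / σ₁ := by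
    field_simp
  rw [hfac, hkey, inv_div]
  field_simp

/-- **Symmetry-forced node ⇒ displacement channel.** If symmetry forces `ω̃₁(x_α) = 0` (`w₁ = 0`) then
the `e₁`-relation reads `σ₁ λ u₁ = R₁`: for a Beltrami host (`σ₁ λ ≠ 0`) the displacement
`ũ₁(x_α)` is fixed by the viscous remainder alone (`u₁ = R₁/(σ₁λ)`; inviscidly `u₁ = 0`). -/
theorem displacement_of_node {σ₁ γ lam u₁ w₁ R₁ : ℝ}
    (hid : (σ₁ - γ) * w₁ = σ₁ * lam * u₁ - R₁) (hw : w₁ = 0) (hσ : σ₁ * lam ≠ 0) :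
    u₁ = R₁ / (σ₁ * lam) := by
  rw [hw, mul_zero] at hid
  rw [eq_div_iff hσ]
  linarith

/-- **Inviscid pinned co-signed mode grows at exactly the stretching rate**: `R₁ = 0`, `u₁ = 0`,
`w₁ ≠ 0` ⇒ `γ = σ₁` (the Cauchy/WKB rate of `ShortWaveHyperbolicTransientGain` §8 and of the
solid-body mode of `StrainedVortexSolidBodyMode`, read off the modal identity). -/
theorem growthRate_of_pinned_inviscid {σ₁ γ lam u₁ w₁ R₁ : ℝ}
    (hid : (σ₁ - γ) * w₁ = σ₁ * lam * u₁ - R₁) (hu : u₁ = 0) (hR : R₁ = 0) (hw : w₁ ≠ 0) :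
    γ = σ₁ := by
  have h := growthRate_of_pinned (κ := 0) hid hu (by rw [hR]; ring) hw
  linarith

end Readings

end Summit.NavierStokesRegularity.FluidComputer.StagnationPointIdentities
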